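import Literature.NumberTheory.LFunctions.KMVMomentAsymptoticsLogWindowTwoBranch
import Literature.NumberTheory.LFunctions.KMVMomentAsymptoticsUniqueness

/-!
LANDING NOTE (typer ls-idea-typ-1 gen 1, cell ls-idea): authored by seat ls-idea-lens-4 gen 2 (sketch
`Sketch_K45.lean` sha16 4de2a1d9222e4b3b, `lean check` rc 0; card K4-5 «CONDUCTOR SPLIT OF THE c = q
REMAINDER / root-log window», critics A PASS as PRODUCER-LINE LOCATION for door-ledger item (I)^{sliver}
(generic branch, dial `b ≥ ½`) · B PASS (batch 11; FIX-1 conceded, F2 correction accepted) · C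
PASS-structure + tree-label FIX (applied)). Landed as PREDICATES with parameters next to
`KMV2000.MomentAsymptoticsLogWindowLevelDep/TwoBranch` (K-I8-7, p562873): the REAL-EXPONENT window
`1 ≤ Δ ≤ 1 + c·(log q̂)^{−b}` (lens-6 §v4b «SLIVER OF RECORD», `θ − 1 = c·(log q̂)^{−b}`), SAME two
displays, SAME Δ-uniform quantifier order; three bookkeeping lemmas PROVED (the sketch's private copy
of `one_lt_qhat` is replaced by the tree's `exists_log_qhat_ge`). The card's printed Type-II input
(Assing–Blomer–Li 2021 Prop. 4.1) lands separately under `Literature/NumberTheory/Sieve/`. Nothing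
beyond `Δ < 1` is asserted. «The programme SEARCHES and TYPES; no claim about Landau–Siegel zeros,
Theorems 1–2 of arXiv:2211.02515 or a repaired Margin232 until a kernel theorem says so.»

## References
* [KowalskiMichelVanderKam2000] E. Kowalski, P. Michel, J. VanderKam, J. reine angew. Math. 526 (2000):
  §6 p. 19 (shape of the two displays), p. 28 L73–L77. [held: paper:doi-10-1515-crll-2000-074]

# The (log q̂)^{−b}-WINDOW moment asymptotics, level-dependent and two-branch (card K4-5; typed ≠ proved)

`MomentAsymptoticsLogWindowLevelDep B` (K-I8-7) has the window `1 ≤ Δ ≤ 1 + B·log log q̂/log q̂`;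
lens-6's ledger §v4b records that the LEAST window the sliver edge can use is a ROOT-LOG / power-of-log
window `Δ − 1 = c·(log q̂)^{−b}`, `b ∈ [½, 1)` (the error of the displays is one log below the main
terms, hence `o((log q̂)^{−b})` for every `b < 1`). Card K4-5 targets this window with a producer line
(conductor split of the `c = q` remainder; crux K1 `MollifierAutoconvUR` fed by Assing–Blomer–Li
Prop. 4.1). This file types the window predicate, its two-branch form, and proves monotonicity in the
window constant and the branch-∅ comparison. Definitions + bookkeeping; nothing asserted.
-/

noncomputable section

open Complex Polynomial Finset
open Literature.NumberTheory.EllipticCurves.ModularForms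

namespace Literature.NumberTheory.LFunctions.KMV2000

/-- **Level-dependent (log q̂)^{−b}-window moment asymptotics** (card K4-5 / lens-6 sliver of record):
as `MomentAsymptoticsLogWindowLevelDep`, window `1 ≤ Δ ≤ 1 + c·(log q̂)^{−b}`.
[cite: KowalskiMichelVanderKam2000, §6 p. 19 (shape of the two displays) and p. 28 L73–L77] -/
def MomentAsymptoticsPowLogWindowLevelDep (b c : ℝ) (T₁ T₂ : ℕ → ℝ → ℝ[X] → ℝ[X] → ℝ) : Prop :=
  ∀ P Q : ℝ[X], KMV2000.Admissible P → IsEvenOrOdd Q →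
    ∃ C : ℝ, ∃ q₀ : ℕ, ∀ (q : ℕ) [NeZero q], q.Prime → q₀ ≤ q → ∀ Δ : ℝ, 1 ≤ Δ →
      Δ ≤ 1 + c * Real.log (qhat q) ^ (-b) →
      (∀ n : ℕ, (n : ℝ) ≠ qhat q ^ Δ) →
        ‖LhPQ q P Q (qhat q ^ Δ) -
            ((riemannZeta 2 * ((Real.sqrt (qhat q) / (Δ * Real.log (qhat q)) : ℝ) : ℂ)) *
              ((KMV2000.linForm Δ P Q + T₁ q Δ P Q : ℝ) : ℂ))‖ ≤
          C * Real.sqrt (qhat q) * (Real.log (qhat q))⁻¹ ^ 2 ∧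
        ‖QhPQ q P Q (qhat q ^ Δ) -
            ((2 * riemannZeta 2 ^ 2 * ((qhat q / (Δ ^ 2 * Real.log (qhat q) ^ 2) : ℝ) : ℂ)) *
              ((KMV2000.secondMomentForm Δ P Q + T₂ q Δ P Q : ℝ) : ℂ))‖ ≤
          C * qhat q * (Real.log (qhat q))⁻¹ ^ 3

/-- The two-branch (Page-dichotomous) shape on the (log q̂)^{−b}-window: `T₁ = 0`, `T₂ q = s q · R`,
`s q ∈ {−1, 0, 1}` (card K-I8-7's shape, card K4-5's target).
[cite: KowalskiMichelVanderKam2000, §6 p. 19 (shape of the two displays)] -/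
def MomentAsymptoticsPowLogWindowTwoBranch (b c : ℝ) (s : ℕ → ℝ) (R : ℝ → ℝ[X] → ℝ[X] → ℝ) : Prop :=
  (∀ q, s q = -1 ∨ s q = 0 ∨ s q = 1) ∧
    MomentAsymptoticsPowLogWindowLevelDep b c (fun _ _ _ _ ↦ 0) (fun q Δ P Q ↦ s q * R Δ P Q)

/-- Monotonicity in the window constant: a wider window (`c ≤ c'`, with `(log q̂)^{−b} ≥ 0`) is a
stronger door (bookkeeping, proved). [cite: KowalskiMichelVanderKam2000, §6 p. 19 (shape of the two displays)] -/
theorem momentAsymptoticsPowLogWindowLevelDep_mono {b c c' : ℝ} (hcc' : c ≤ c')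
    {T₁ T₂ : ℕ → ℝ → ℝ[X] → ℝ[X] → ℝ} (h : MomentAsymptoticsPowLogWindowLevelDep b c' T₁ T₂) :
    MomentAsymptoticsPowLogWindowLevelDep b c T₁ T₂ := by
  intro P Q hP hQ
  obtain ⟨C, q₀, H⟩ := h P Q hP hQ
  obtain ⟨N, hN⟩ := exists_log_qhat_ge 0
  refine ⟨C, max q₀ N, fun q _ hq hq₀ Δ h1 h2 hM ↦ H q hq (le_trans (le_max_left _ _) hq₀) Δ h1 ?_ hM⟩
  have hlog : 0 ≤ Real.log (qhat q) := hN q (le_trans (le_max_right _ _) hq₀)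
  have hpow : 0 ≤ Real.log (qhat q) ^ (-b) := Real.rpow_nonneg hlog _
  calc Δ ≤ 1 + c * Real.log (qhat q) ^ (-b) := h2
    _ ≤ 1 + c' * Real.log (qhat q) ^ (-b) := by gcongr

/-- Branch ∅ everywhere (`s ≡ 0`) of the two-branch shape gives zero tables (bookkeeping, proved).
[cite: KowalskiMichelVanderKam2000, §6 p. 19 (shape of the two displays)] -/
theorem momentAsymptoticsPowLogWindow_of_twoBranch_null {b c : ℝ} {R : ℝ → ℝ[X] → ℝ[X] → ℝ}
    (h : MomentAsymptoticsPowLogWindowTwoBranch b c (fun _ ↦ 0) R) :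
    MomentAsymptoticsPowLogWindowLevelDep b c (fun _ _ _ _ ↦ 0) (fun _ _ _ _ ↦ 0) := by
  intro P Q hP hQ
  obtain ⟨C, q₀, H⟩ := h.2 P Q hP hQ
  refine ⟨C, q₀, fun q _ hq hq₀ Δ h1 h2 hM ↦ ?_⟩
  simpa using H q hq hq₀ Δ h1 h2 hM

/-- Monotonicity in the window EXPONENT (lens-10 K-L10-2 typing want, proved): for `b ≤ b'` the
`(log q̂)^{−b'}`-window is the narrower one once `log q̂ ≥ 1`, so the `b`-window door implies the
`b'`-window door (for `c < 0` both windows are empty above `Δ = 1` and the claim is vacuous).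
[cite: KowalskiMichelVanderKam2000, §6 p. 19 (shape of the two displays)] -/
theorem momentAsymptoticsPowLogWindowLevelDep_mono_exponent {b b' c : ℝ} (hbb' : b ≤ b')
    {T₁ T₂ : ℕ → ℝ → ℝ[X] → ℝ[X] → ℝ} (h : MomentAsymptoticsPowLogWindowLevelDep b c T₁ T₂) :
    MomentAsymptoticsPowLogWindowLevelDep b' c T₁ T₂ := by
  intro P Q hP hQ
  obtain ⟨C, q₀, H⟩ := h P Q hP hQ
  obtain ⟨N, hN⟩ := exists_log_qhat_ge 1
  refine ⟨C, max q₀ N, fun q _ hq hq₀ Δ h1 h2 hM ↦ H q hq (le_trans (le_max_left _ _) hq₀) Δ h1 ?_ hM⟩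
  have hlog : 1 ≤ Real.log (qhat q) := hN q (le_trans (le_max_right _ _) hq₀)
  have hpow : Real.log (qhat q) ^ (-b') ≤ Real.log (qhat q) ^ (-b) :=
    Real.rpow_le_rpow_of_exponent_le hlog (neg_le_neg hbb')
  have hpos : 0 < Real.log (qhat q) ^ (-b') := Real.rpow_pos_of_pos (by linarith) _
  rcases le_or_gt 0 c with hc | hc
  · calc Δ ≤ 1 + c * Real.log (qhat q) ^ (-b') := h2
      _ ≤ 1 + c * Real.log (qhat q) ^ (-b) := by gcongr
  · exfalso
    have : c * Real.log (qhat q) ^ (-b') < 0 := mul_neg_of_neg_of_pos hc hpos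
    linarith

end Literature.NumberTheory.LFunctions.KMV2000
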